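import Literature.NumberTheory.EllipticCurves.IwasawaTowerTorsionPotGoodFiniteProofs
import Mathlib.RingTheory.Polynomial.Cyclotomic.Roots
import Mathlib.RingTheory.Polynomial.Cyclotomic.Eval
import Mathlib.RingTheory.DedekindDomain.AdicValuation
import HarnessLib

/-!
# No primitive `p`-th root of unity in the completion `K_v` at a place `v` with `v = (p)` (`p` odd): `v(ζ − 1)^{p−1} = v(p) = exp(−1)` is impossible

INPUTS hand `bsd-inputs-honda-p1` g28 (cell `bsd-ssimc`, crux L stmt-BirchSwinnertonDyer-23599, line `rtt_w3` v30, stub S3α′): the input `hμ` of the tree's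
`IwasawaTowerTorsion.WeierstrassCurve.exists_pTorsion_not_fixed_of_no_primitiveRoot` at an INERT (more generally: unramified principal, `v.asIdeal = (p)`) place — the tree had it only for
degree-one places (`…_of_degreeOne`, `K_𝔭 ↪ ℚ_p`). THEOREMS ONLY. Proof: `Φ_p(1) = p = ∏_{μ primitive} (1 − μ)` and all `v(1 − μ)` are equal (`μ`, `ζ` are powers of each other,
`x^a − 1 = (x − 1)(1 + … + x^{a−1})`), so `v(ζ − 1)^{p−1} = v(p) = exp(−1)` in `ℤᵐ⁰` (`p` generates `v`): `(p − 1) ∣ 1`, i.e. `p = 2`. HONEST FRAMING: a local lemma; nothing about BSD.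
References: [Robert2000PadicAnalysis] Ch. III §4.3–4.4; [SerreLocalFields1979] IV §4 Prop. 17; [Washington1997] Lemma 1.4 / Prop. 2.8.
-/

set_option autoImplicit false
set_option linter.dupNamespace false -- D-0017: single-problem summit, the namespace repeats the problem name by design
noncomputable section

open scoped Classical Polynomial
open NumberField IsDedekindDomain WithZero

namespace Summit.BirchSwinnertonDyer.BirchSwinnertonDyer.Theorems.SmallImageRttJunctionSha

section NoPthRoot

variable {L : Type*} [Field L] {Γ₀ : Type*} [LinearOrderedCommGroupWithZero Γ₀] (val : Valuation L Γ₀)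

/-- `v(x^a − 1) ≤ v(x − 1)` when `v(x) ≤ 1` (`x^a − 1 = (x − 1)·Σ x^i`). [cite: Robert2000PadicAnalysis, Ch. III §4.3] -/
theorem valuation_pow_sub_one_le {x : L} (hx : val x ≤ 1) (a : ℕ) : val (x ^ a - 1) ≤ val (x - 1) := by
  rw [← geom_sum_mul, map_mul]
  have hs : val (∑ i ∈ Finset.range a, x ^ i) ≤ 1 := by
    refine val.map_sum_le fun i _ ↦ ?_
    rw [map_pow]
    exact pow_le_one₀ (by first | exact _root_.zero_le _ | exact _root_.zero_le) hx
  calc val (∑ i ∈ Finset.range a, x ^ i) * val (x - 1) ≤ 1 * val (x - 1) := mul_le_mul' hs le_rfl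
    _ = val (x - 1) := one_mul _

/-- Roots of unity have valuation `1`. [cite: Robert2000PadicAnalysis, Ch. III §4.3] -/
theorem valuation_eq_one_of_pow_eq_one {x : L} {n : ℕ} (hn : n ≠ 0) (h : x ^ n = 1) : val x = 1 := by
  have h1 : val x ^ n = 1 := by rw [← map_pow, h, map_one]
  exact (pow_eq_one_iff.mp h1).resolve_right hn

/-- Two primitive `n`-th roots of unity are at the same distance from `1`: `v(μ − 1) = v(ζ − 1)`. [cite: Robert2000PadicAnalysis, Ch. III §4.4] -/
theorem valuation_sub_one_eq_of_isPrimitiveRoot {ζ μ : L} {n : ℕ} (hn : n ≠ 0) (hζ : IsPrimitiveRoot ζ n) (hμ : IsPrimitiveRoot μ n) :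
    val (μ - 1) = val (ζ - 1) := by
  haveI : NeZero n := ⟨hn⟩
  obtain ⟨i, -, rfl⟩ := hζ.eq_pow_of_pow_eq_one hμ.pow_eq_one
  refine le_antisymm (valuation_pow_sub_one_le val (valuation_eq_one_of_pow_eq_one val hn hζ.pow_eq_one).le i) ?_
  obtain ⟨j, -, hj⟩ := hμ.eq_pow_of_pow_eq_one hζ.pow_eq_one
  calc val (ζ - 1) = val ((ζ ^ i) ^ j - 1) := by rw [hj]
    _ ≤ val (ζ ^ i - 1) := valuation_pow_sub_one_le val (valuation_eq_one_of_pow_eq_one val hn hμ.pow_eq_one).le j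

/-- **`v(ζ − 1)^{p−1} = v(p)`** for a primitive `p`-th root of unity `ζ` (`Φ_p(1) = p`, `Φ_p = ∏ (X − μ)`). [cite: Robert2000PadicAnalysis, Ch. III §4.4] -/
theorem valuation_sub_one_pow_eq_valuation_natCast {p : ℕ} [hp : Fact p.Prime] {ζ : L} (hζ : IsPrimitiveRoot ζ p) :
    val (ζ - 1) ^ (p - 1) = val (p : L) := by
  have heval : (Polynomial.cyclotomic p L).eval 1 = (p : L) := Polynomial.eval_one_cyclotomic_prime
  rw [Polynomial.cyclotomic_eq_prod_X_sub_primitiveRoots hζ, Polynomial.eval_prod] at heval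
  simp only [Polynomial.eval_sub, Polynomial.eval_X, Polynomial.eval_C] at heval
  rw [← heval, map_prod]
  have hconst : ∀ μ ∈ primitiveRoots p L, val (1 - μ) = val (ζ - 1) := fun μ hμ ↦ by
    rw [← Valuation.map_neg, neg_sub]
    exact valuation_sub_one_eq_of_isPrimitiveRoot val hp.out.ne_zero hζ ((mem_primitiveRoots hp.out.pos).mp hμ)
  rw [Finset.prod_congr rfl hconst, Finset.prod_const, hζ.card_primitiveRoots, Nat.totient_prime hp.out]

end NoPthRoot

section Completion

variable {K : Type} [Field K] [NumberField K] {p : ℕ} [hp : Fact p.Prime] (v : HeightOneSpectrum (𝓞 K))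

/-- ★★ **No primitive `p`-th root of unity in `K_v` when `v = (p)` and `p` is odd** (`K_v/ℚ_p` unramified: `v(p) = exp(−1)` in `ℤᵐ⁰`, while `v(ζ − 1)^{p−1} = v(p)` forces `(p − 1) ∣ 1`). The
input `hμ` of `exists_pTorsion_not_fixed_of_no_primitiveRoot` at an inert prime. [cite: SerreLocalFields1979, IV §4 Prop. 17] [cite: Washington1997, Lemma 1.4] -/
theorem not_isPrimitiveRoot_adicCompletion_of_asIdeal_eq_span (hp2 : p ≠ 2) (hv : v.asIdeal = Ideal.span {((p : ℕ) : 𝓞 K)})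
    (z : v.adicCompletion K) : ¬ IsPrimitiveRoot z p := by
  intro hz
  have hp0 : ((p : ℕ) : 𝓞 K) ≠ 0 := Nat.cast_ne_zero.mpr hp.out.ne_zero
  -- `v(p) = exp (-1)` on `K_v`
  have hvp : Valued.v ((p : ℕ) : v.adicCompletion K) = exp (-1 : ℤ) := by
    have h := HeightOneSpectrum.valuedAdicCompletion_eq_valuation (K := K) v ((p : ℕ) : 𝓞 K)
    rw [HeightOneSpectrum.valuation_of_algebraMap, HeightOneSpectrum.intValuation_singleton v hp0 hv] at h
    rw [← h]
    congr 1
    simp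
  -- `v(ζ - 1)^(p-1) = exp (-1)`
  have hpow := valuation_sub_one_pow_eq_valuation_natCast (Valued.v : Valuation (v.adicCompletion K) ℤᵐ⁰) hz
  rw [hvp] at hpow
  have hz1 : z - 1 ≠ 0 := sub_ne_zero.mpr (hz.ne_one hp.out.one_lt)
  have hne : Valued.v (z - 1) ≠ (0 : ℤᵐ⁰) := (Valuation.ne_zero_iff _).mpr hz1
  obtain ⟨m, hm⟩ : ∃ m : ℤ, Valued.v (z - 1) = exp m := ⟨log (Valued.v (z - 1)), (exp_log hne).symm⟩
  rw [hm, ← exp_nsmul] at hpow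
  have hint : ((p - 1 : ℕ) : ℤ) * m = -1 := by
    have := exp_injective hpow
    rw [nsmul_eq_mul] at this
    exact this
  have habs : (p - 1) * m.natAbs = 1 := by
    have := congrArg Int.natAbs hint
    rwa [Int.natAbs_mul, Int.natAbs_natCast, Int.natAbs_neg, Int.natAbs_one] at this
  have hle : p - 1 ≤ 1 := Nat.le_of_dvd Nat.one_pos (Dvd.intro _ habs)
  have := hp.out.two_le
  omega

end Completion

end Summit.BirchSwinnertonDyer.BirchSwinnertonDyer.Theorems.SmallImageRttJunctionSha

end
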